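import Literature.Probability.LatticeModels.ScaleFrame
import Literature.Probability.Percolation.Crossings
import Literature.Probability.LatticeModels.RandomClusterConditionalDomination
import Literature.Probability.LatticeModels.RandomClusterRegionToAnnulus
import Literature.Probability.LatticeModels.RandomClusterBoundaryPushingTools
import Literature.Probability.LatticeModels.FKIsingAnnulusCrossingProofs
import HarnessLib

/-!
# Quasi-multiplicativity on a scale frame: the upper bound (proved)

Topic `Literature/Probability/LatticeModels` (trunk `StatMech`, family `crit-ising`). The upper
half of Kesten's quasi-multiplicativity of connection probabilities across nested annuli
(H. Kesten, PTRF 73 (1986), §2, eqs. (29)–(30); D. Basu, A. Sapozhnikov, ECP 22 (2017), §2) for the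
finite-graph random-cluster measure `rcMeasure`, `q ≥ 1`, on an abstract `ScaleFrame` (no
planarity): under the one-block measure of a set `W` of good vertices of radius `< aM^15` (frame
edges inside `W`; inner blob `R'` of radius `≤ a` and outer blob `Y` of radius `> aM^14 - η` wired
into ONE cluster), the probability of an open path `R' ↔ Y` inside `W` is at most `g₁ g₂`, where
`g₁` is the inner arm factor (open path from `R'` to radius `≥ aM^3` inside `U₁ = W ∩ {rad < aM^6}`,
local measure of `U₁` with `R'` and the layer `{rad ≥ aM^6 - η}` wired) and `g₂` the outer arm
factor (open path from radius `≤ aM^11` to `Y` inside `U₂ = W ∩ {rad > aM^8}`, local measure of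
`U₂` with `Y` and the layer `{rad ≤ aM^8 + η}` wired). No RSW input: an open path `R' ↔ Y`
contains an inner arm inside `U₁` (up to its first vertex of radius `≥ aM^3`; radii move by `< η`
along edges) and an outer arm inside `U₂` (after its last vertex of radius `≤ aM^11`); the arms
live on the disjoint edge regions of `U₁` and `U₂`, and the domain Markov property with
comparison of boundary conditions (`rcMeasure_real_inter_cylinder_le_mul_fromEdgeSet`) bounds the
joint probability by the product of the probabilities under the local measures wired on all
touched vertices; these lie in the stated layers by the continuity of the radius along edges
(`adj_good`), and monotonicity in the wired set (`rcMeasure_real_mono_wired_of_isUpperSet`)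
concludes.

* `rcMeasure_real_restrict_inter_le_mul`, `rcMeasure_real_le_mul_of_two_regions` — domain Markov
  towards a region summed over an event determined off it; the product bound for two regions;
* `ScaleFrame.openCrossing_split` — the path splitting; `ScaleFrame.quasiMult_upper` — the bound.

## References

* H. Kesten, The incipient infinite cluster in two-dimensional percolation, *Probab. Theory
  Related Fields* 73 (1986) 369–394: §2, eqs. (29)–(30).
* D. Basu, A. Sapozhnikov, Kesten's incipient infinite cluster and quasi-multiplicativity of
  crossing probabilities, *Electron. Commun. Probab.* 22 (2017) no. 26, §2.
* G. Grimmett, *The Random-Cluster Model*, Springer (2006): Lemma (4.13), Lemma (4.14).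
-/

noncomputable section

open MeasureTheory Finset SimpleGraph
open Literature.Probability.Percolation (BondConfig openConnIn openCrossing)

namespace Literature.Probability.LatticeModels

/-! ### Random-cluster tools: domain Markov towards a region, two regions -/

section Tools

variable {V : Type*} [Fintype V] [DecidableEq V] (G : SimpleGraph V) [DecidableRel G.Adj]

/-- **Domain Markov towards a region, summed over an event determined off the region** (Grimmett
2006, Lemma (4.13) with Lemma (4.14)(b); Duminil-Copin–Smirnov 2012, §3.2 and Thm. 3.1): for a
region `U ⊆ E(G)`, a vertex set `W ⊇ B` containing both endpoints of every edge of `G` off `U`, an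
increasing event `A` and an event `F` determined by the configuration off `U`,
`φ^B_G({ω ∩ U ∈ A} ∩ F) ≤ φ^W_{⟨U⟩}(A) · φ^B_G(F)`.
[cite: Grimmett2006, Lemma (4.13) and Lemma (4.14)(b)] -/
theorem rcMeasure_real_restrict_inter_le_mul {p q : ℝ} (hp : p ∈ Set.Icc (0 : ℝ) 1) (hq : 1 ≤ q)
    (B : Set V) (U : Finset (Sym2 V)) (hU : U ⊆ G.edgeFinset) {W : Set V} (hBW : B ⊆ W)
    (hW : ∀ e ∈ G.edgeFinset, e ∉ U → ∀ x ∈ e, x ∈ W)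
    {A : Set (BondConfig V)} (hA : IsUpperSet A) {F : Set (BondConfig V)}
    (hF : ∀ ω₁ ω₂ : BondConfig V, ω₁ ∩ (↑U)ᶜ = ω₂ ∩ (↑U)ᶜ → (ω₁ ∈ F ↔ ω₂ ∈ F)) :
    (rcMeasure G p q B).real ({ω | ω ∩ ↑U ∈ A} ∩ F) ≤
      (rcMeasure (fromEdgeSet (U : Set (Sym2 V))) p q W).real A * (rcMeasure G p q B).real F := by
  have hq0 : 0 < q := one_pos.trans_le hq
  refine rcMeasure_real_inter_le_mul_of_cylinder_le G hp hq0 B U hF fun ξ hξ ↦ ?_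
  rw [mul_comm]
  refine rcMeasure_real_inter_cylinder_le_mul_fromEdgeSet G hp hq B U hU _ hBW
    (fun e he x hx ↦ ?_) hA
  have he' := Finset.mem_sdiff.1 (hξ (Finset.mem_coe.1 he))
  exact hW e he'.1 he'.2 x hx

/-- **Two disjoint regions: the product bound** (the mechanism of Kesten's quasi-multiplicativity
upper bound, 1986, §2 eq. (29); Basu–Sapozhnikov 2017, §2): if on lattice configurations the event
`X` forces an increasing event `A₁` of the configuration on the region `U₁` and an increasing
event `A₂` of the configuration on a disjoint region `U₂`, then
`φ^B_G(X) ≤ φ^{W₁}_{⟨U₁⟩}(A₁) · φ^{W₂}_{⟨U₂⟩}(A₂)` for any `W_i ⊇ B` containing both endpoints of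
every edge of `G` off `U_i`. [cite: Kesten1986, §2 eq. (29)] -/
theorem rcMeasure_real_le_mul_of_two_regions {p q : ℝ} (hp : p ∈ Set.Icc (0 : ℝ) 1) (hq : 1 ≤ q)
    (B : Set V) {U₁ U₂ : Finset (Sym2 V)} (hU₁ : U₁ ⊆ G.edgeFinset) (hU₂ : U₂ ⊆ G.edgeFinset)
    (hdisj : Disjoint U₂ U₁) {W₁ W₂ : Set V} (hB₁ : B ⊆ W₁) (hB₂ : B ⊆ W₂)
    (hW₁ : ∀ e ∈ G.edgeFinset, e ∉ U₁ → ∀ x ∈ e, x ∈ W₁)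
    (hW₂ : ∀ e ∈ G.edgeFinset, e ∉ U₂ → ∀ x ∈ e, x ∈ W₂)
    {X A₁ A₂ : Set (BondConfig V)} (hA₁ : IsUpperSet A₁) (hA₂ : IsUpperSet A₂)
    (hX : ∀ ω : BondConfig V, ω ⊆ G.edgeSet → ω ∈ X → ω ∩ ↑U₁ ∈ A₁ ∧ ω ∩ ↑U₂ ∈ A₂) :
    (rcMeasure G p q B).real X ≤
      (rcMeasure (fromEdgeSet (U₁ : Set (Sym2 V))) p q W₁).real A₁ *
        (rcMeasure (fromEdgeSet (U₂ : Set (Sym2 V))) p q W₂).real A₂ := by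
  have hq0 : 0 < q := one_pos.trans_le hq
  haveI := isProbabilityMeasure_rcMeasure G hp hq0 B
  -- the event on `U₂` is determined off `U₁`
  have hF : ∀ ω₁ ω₂ : BondConfig V, ω₁ ∩ (↑U₁)ᶜ = ω₂ ∩ (↑U₁)ᶜ →
      (ω₁ ∈ {ω : BondConfig V | ω ∩ ↑U₂ ∈ A₂} ↔ ω₂ ∈ {ω : BondConfig V | ω ∩ ↑U₂ ∈ A₂}) :=
    determined_off_of_determined_on_disjoint hdisj fun ω₁ ω₂ h ↦ by
      simp only [Set.mem_setOf_eq]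
      rw [h]
  have huniv : ∀ ω₁ ω₂ : BondConfig V, ω₁ ∩ (↑U₂)ᶜ = ω₂ ∩ (↑U₂)ᶜ →
      (ω₁ ∈ (Set.univ : Set (BondConfig V)) ↔ ω₂ ∈ (Set.univ : Set (BondConfig V))) :=
    fun _ _ _ ↦ by simp only [Set.mem_univ]
  have h2 := rcMeasure_real_restrict_inter_le_mul G hp hq B U₂ hU₂ hB₂ hW₂ hA₂ huniv
  rw [Set.inter_univ, probReal_univ, mul_one] at h2
  calc (rcMeasure G p q B).real X
      ≤ (rcMeasure G p q B).real ({ω | ω ∩ ↑U₁ ∈ A₁} ∩ {ω | ω ∩ ↑U₂ ∈ A₂}) :=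
        rcMeasure_real_mono_of_forall_subset_edgeSet G hp hq0 B fun ω hω hωX ↦ hX ω hω hωX
    _ ≤ (rcMeasure (fromEdgeSet (U₁ : Set (Sym2 V))) p q W₁).real A₁ *
          (rcMeasure G p q B).real {ω | ω ∩ ↑U₂ ∈ A₂} :=
        rcMeasure_real_restrict_inter_le_mul G hp hq B U₁ hU₁ hB₁ hW₁ hA₁ hF
    _ ≤ (rcMeasure (fromEdgeSet (U₁ : Set (Sym2 V))) p q W₁).real A₁ *
          (rcMeasure (fromEdgeSet (U₂ : Set (Sym2 V))) p q W₂).real A₂ :=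
        mul_le_mul_of_nonneg_left h2 measureReal_nonneg

end Tools

/-! ### Path splitting on a scale frame -/

namespace ScaleFrame

variable {V : Type*} [Fintype V] [DecidableEq V] (F : ScaleFrame V)

/-- Geometric scales are monotone: `aM^i ≤ aM^j` for `i ≤ j` (`a > 0`, `M ≥ 4`). [folklore] -/
theorem scale_mono {a M : ℝ} (ha : 0 < a) (hM : 4 ≤ M) {i j : ℕ} (hij : i ≤ j) :
    a * M ^ i ≤ a * M ^ j :=
  mul_le_mul_of_nonneg_left (pow_le_pow_right₀ (by linarith) hij) ha.le

/-- Consecutive geometric scales are separated by at least `a`: `aM^i + a ≤ aM^j` for `i < j`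
(`a > 0`, `M ≥ 4`). [folklore] -/
theorem scale_gap {a M : ℝ} (ha : 0 < a) (hM : 4 ≤ M) {i j : ℕ} (hij : i < j) :
    a * M ^ i + a ≤ a * M ^ j := by
  have h1 : (1 : ℝ) ≤ M ^ i := one_le_pow₀ (by linarith)
  have ht : a ≤ a * M ^ i := le_mul_of_one_le_right ha.le h1
  have hprod : a * M ^ i * 4 ≤ a * M ^ i * M := mul_le_mul_of_nonneg_left hM (by positivity)
  have h2 : a * M ^ (i + 1) ≤ a * M ^ j := scale_mono ha hM hij
  rw [pow_succ, ← mul_assoc] at h2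
  linarith

/-- **Splitting an open path across the scales of a frame** (Kesten 1986, §2, proof of (29): "a
connection from the inside to the outside contains a crossing of each annulus in between"). Let
`W` consist of good vertices of radius `< aM^15 ≤ Rmax`, `R' ⊆ {rad ≤ a}`, `Y ⊆ {rad > aM^14 - η}`
(`η ≤ a`, `M ≥ 4`), and let `ω` be a configuration of frame edges inside `W` with an open path from
`R'` to `Y` inside `W`. Then `ω` has an open path inside `U₁ = W ∩ {rad < aM^6}` from `R'` to a
vertex of radius `≥ aM^3` (the initial piece up to the first such vertex: radii move by `< η` along
edges), and an open path inside `U₂ = W ∩ {rad > aM^8}` from a vertex of radius `≤ aM^11` to `Y`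
(the final piece after the last such vertex). [cite: Kesten1986, §2 eq. (29)] -/
theorem openCrossing_split {a M : ℝ} (ha : 0 < a) (hM : 4 ≤ M) (hR : a * M ^ 15 ≤ F.Rmax)
    (hη : F.η ≤ a) {W R' Y : Set V} (hW : ∀ v ∈ W, v ∈ F.good ∧ F.rad v < a * M ^ 15)
    (hR' : ∀ v ∈ R', F.rad v ≤ a) (hY : ∀ v ∈ Y, a * M ^ 14 - F.η < F.rad v) {ω : BondConfig V}
    (hω : ω ⊆ (fromEdgeSet (↑(F.edgesWithin W) : Set (Sym2 V))).edgeSet)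
    (hωX : ω ∈ openCrossing W R' Y) :
    ω ∈ openCrossing (W ∩ {v | F.rad v < a * M ^ 6}) R'
        ((W ∩ {v | F.rad v < a * M ^ 6}) ∩ {v | a * M ^ 3 ≤ F.rad v}) ∧
      ω ∈ openCrossing (W ∩ {v | a * M ^ 8 < F.rad v})
        ((W ∩ {v | a * M ^ 8 < F.rad v}) ∩ {v | F.rad v ≤ a * M ^ 11}) Y := by
  obtain ⟨r, hr, y, hy, hry⟩ := hωX
  rw [Percolation.mem_openConnIn_iff_pathIn] at hry
  -- open pairs are frame edges inside `W`, along which the radius moves by less than `η`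
  have hedge : ∀ x z, (Percolation.openGraph ω).Adj x z → s(x, z) ∈ F.E ∧ x ∈ W ∧ z ∈ W := by
    intro x z hxz
    rw [Percolation.openGraph_adj] at hxz
    have h : (fromEdgeSet (↑(F.edgesWithin W) : Set (Sym2 V))).Adj x z := hω hxz.1
    rw [fromEdgeSet_adj, Finset.mem_coe, mem_edgesWithin] at h
    exact ⟨h.1.1, h.1.2 x (Sym2.mem_mk_left x z), h.1.2 z (Sym2.mem_mk_right x z)⟩
  have hadj : ∀ x z, (Percolation.openGraph ω).Adj x z → F.rad z < F.rad x + F.η ∧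
      F.rad x - F.η < F.rad z := by
    intro x z hxz
    obtain ⟨he, hx, -⟩ := hedge x z hxz
    have h := (abs_lt.1 (F.adj_good _ he x (Sym2.mem_mk_left x z) z (Sym2.mem_mk_right x z)
      (hW x hx).1 ((hW x hx).2.trans_le hR)).2)
    constructor <;> linarith [h.1, h.2]
  have hηpos := F.η_pos
  have h03 : a * M ^ 0 + a ≤ a * M ^ 3 := scale_gap ha hM (by norm_num)
  have h36 : a * M ^ 3 + a ≤ a * M ^ 6 := scale_gap ha hM (by norm_num)
  have h68 : a * M ^ 6 ≤ a * M ^ 8 := scale_mono ha hM (by norm_num)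
  have h811 : a * M ^ 8 + a ≤ a * M ^ 11 := scale_gap ha hM (by norm_num)
  have h1114 : a * M ^ 11 + a ≤ a * M ^ 14 := scale_gap ha hM (by norm_num)
  rw [pow_zero, mul_one] at h03
  have hry' := hR' r hr
  have hyy := hY y hy
  constructor
  · -- the initial piece, up to the first vertex of radius `≥ aM^3`
    have hrR : r ∈ {v | F.rad v < a * M ^ 3} := by
      show F.rad r < a * M ^ 3
      linarith
    have hyR : y ∉ {v | F.rad v < a * M ^ 3} := by
      show ¬ F.rad y < a * M ^ 3
      exact not_lt.2 (by linarith)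
    obtain ⟨b, c, hb, hc, hcW, hbc, hpath⟩ := hry.exit hrR hyR
    have hb' : F.rad b < a * M ^ 3 := hb
    have hc' : a * M ^ 3 ≤ F.rad c := not_lt.1 hc
    have hc6 : F.rad c < a * M ^ 6 := by linarith [(hadj b c hbc).1]
    refine ⟨r, hr, c, ⟨⟨hcW, hc6⟩, hc'⟩, ?_⟩
    rw [Percolation.mem_openConnIn_iff_pathIn]
    refine (hpath.mono ?_).tail hbc ?_
    · intro v hv
      have hv' : F.rad v < a * M ^ 3 := hv.1
      exact ⟨hv.2, show F.rad v < a * M ^ 6 by linarith⟩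
    · exact ⟨hcW, hc6⟩
  · -- the final piece, after the last vertex of radius `≤ aM^11`
    have hrC : r ∈ {v | F.rad v ≤ a * M ^ 11} := by
      show F.rad r ≤ a * M ^ 11
      linarith [h36, h811]
    have hyC : y ∉ {v | F.rad v ≤ a * M ^ 11} := by
      show ¬ F.rad y ≤ a * M ^ 11
      exact not_le.2 (by linarith)
    obtain ⟨b, c, hb, hbW, hc, hbc, hpath⟩ := hry.last_exit hrC hyC
    have hb' : F.rad b ≤ a * M ^ 11 := hb
    have hc' : a * M ^ 11 < F.rad c := not_le.1 hc
    have hcW : c ∈ W := hpath.left_mem.1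
    have hb8 : a * M ^ 8 < F.rad b := by linarith [(hadj c b hbc.symm).2]
    have hc8 : a * M ^ 8 < F.rad c := by linarith
    refine ⟨b, ⟨⟨hbW, hb8⟩, hb'⟩, y, hy, ?_⟩
    rw [Percolation.mem_openConnIn_iff_pathIn]
    refine (Percolation.PathIn.of_adj ?_ ?_ hbc).trans (hpath.mono ?_)
    · exact ⟨hbW, hb8⟩
    · exact ⟨hcW, hc8⟩
    · intro v hv
      have hv' : ¬ F.rad v ≤ a * M ^ 11 := hv.2
      exact ⟨hv.1, show a * M ^ 8 < F.rad v by linarith [not_le.1 hv']⟩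

end ScaleFrame

/-! ### The upper bound -/

/-- **Kesten's quasi-multiplicativity, upper bound, on a scale frame** (Kesten 1986, §2,
eqs. (29)–(30); Basu–Sapozhnikov 2017, §2): the connection between an inner wired blob `R'`
(radius `≤ a`) and an outer wired blob `Y` (radius `> aM^14 - η`) inside a vertex set `W` of good
vertices of radius `< aM^15`, under the one-block measure `rcMeasure ⟨edgesWithin W⟩ p q (R' ∪ Y)`,
is at most the product of the inner arm factor `g₁` (crossing from `R'` to scale `aM^3` inside
`U₁ = W ∩ {rad < aM^6}`, outer layer wired with `R'`) and the outer arm factor `g₂` (crossing from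
scale `aM^11` to `Y` inside `U₂ = W ∩ {aM^8 < rad}`, inner layer wired with `Y`). No RSW needed:
domain Markov and monotonicity in the boundary condition. [cite: Kesten1986, §2 eqs. (29)–(30)] -/
theorem ScaleFrame.quasiMult_upper :
    ∀ {V : Type*} [Fintype V] [DecidableEq V] (F : ScaleFrame V) {p q a M : ℝ},
      p ∈ Set.Ico (0 : ℝ) 1 → 1 ≤ q → 0 < a → 4 ≤ M → a * M ^ 15 ≤ F.Rmax → F.η ≤ a →
    ∀ (W R' Y : Set V),
      (∀ v ∈ W, v ∈ F.good ∧ F.rad v < a * M ^ 15) → R' ⊆ W → Y ⊆ W →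
      (∀ v ∈ R', F.rad v ≤ a) → (∀ v ∈ Y, a * M ^ 14 - F.η < F.rad v) →
      let ν := rcMeasure (fromEdgeSet (↑(F.edgesWithin W) : Set (Sym2 V))) p q (R' ∪ Y)
      let U₁ : Set V := W ∩ {v | F.rad v < a * M ^ 6}
      let U₂ : Set V := W ∩ {v | a * M ^ 8 < F.rad v}
      let g₁ := (rcMeasure (fromEdgeSet (↑(F.edgesWithin U₁) : Set (Sym2 V))) p q
        (R' ∪ {v | a * M ^ 6 - F.η ≤ F.rad v})).real (openCrossing U₁ R' (U₁ ∩ {v | a * M ^ 3 ≤ F.rad v}))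
      let g₂ := (rcMeasure (fromEdgeSet (↑(F.edgesWithin U₂) : Set (Sym2 V))) p q
        (Y ∪ {v | F.rad v ≤ a * M ^ 8 + F.η})).real (openCrossing U₂ (U₂ ∩ {v | F.rad v ≤ a * M ^ 11}) Y)
      ν.real (openCrossing W R' Y) ≤ g₁ * g₂ := by
  intro V _ _ F p q a M hp hq ha hM hR hη W R' Y hW hR'W hYW hR' hY ν U₁ U₂ g₁ g₂
  have hp' : p ∈ Set.Icc (0 : ℝ) 1 := ⟨hp.1, hp.2.le⟩
  have hηpos := F.η_pos
  have h08 : a * M ^ 0 ≤ a * M ^ 8 := ScaleFrame.scale_mono ha hM (by norm_num)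
  have h68 : a * M ^ 6 ≤ a * M ^ 8 := ScaleFrame.scale_mono ha hM (by norm_num)
  have h614 : a * M ^ 6 ≤ a * M ^ 14 := ScaleFrame.scale_mono ha hM (by norm_num)
  rw [pow_zero, mul_one] at h08
  -- the radius moves by less than `η` along a frame edge at a vertex of `W`
  have hadj : ∀ e ∈ F.E, ∀ u ∈ e, ∀ v ∈ e, u ∈ W →
      F.rad v < F.rad u + F.η ∧ F.rad u - F.η < F.rad v := by
    intro e he u hu v hv huW
    have h := abs_lt.1 (F.adj_good e he u hu v hv (hW u huW).1 ((hW u huW).2.trans_le hR)).2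
    constructor <;> linarith [h.1, h.2]
  -- the region of a vertex set `S`: the genuine frame edges inside `S`
  have hreg : ∀ S : Set V, S ⊆ W → ∃ U : Finset (Sym2 V),
      (∀ e, e ∈ U ↔ (e ∈ F.E ∧ ∀ v ∈ e, v ∈ S) ∧ ¬ e.IsDiag) ∧
      fromEdgeSet (↑U : Set (Sym2 V)) = fromEdgeSet (↑(F.edgesWithin S) : Set (Sym2 V)) ∧
      (∀ i, U ⊆ @edgeFinset V (fromEdgeSet (↑(F.edgesWithin W) : Set (Sym2 V))) i) ∧
      (∀ e ∈ F.edgesWithin W, ¬ e.IsDiag → e ∉ U → e ∈ F.E ∧ ∃ v ∈ e, v ∈ W ∧ v ∉ S) ∧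
      ∀ (ω : BondConfig V) (u v : V),
        ω ⊆ (fromEdgeSet (↑(F.edgesWithin W) : Set (Sym2 V))).edgeSet →
        ω ∈ openConnIn S u v → ω ∩ ↑U ∈ openConnIn S u v := by
    intro S hSW
    have hU : ∀ e, e ∈ (F.edgesWithin S).filter (fun e ↦ ¬ e.IsDiag) ↔
        (e ∈ F.E ∧ ∀ v ∈ e, v ∈ S) ∧ ¬ e.IsDiag := fun e ↦ by
      rw [Finset.mem_filter, ScaleFrame.mem_edgesWithin]
    refine ⟨(F.edgesWithin S).filter fun e ↦ ¬ e.IsDiag, hU, ?_, fun i e he ↦ ?_, ?_, ?_⟩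
    · ext x z
      simp only [fromEdgeSet_adj, Finset.mem_coe, hU, ScaleFrame.mem_edgesWithin,
        Sym2.mk_isDiag_iff]
      tauto
    · exact (mem_edgeFinset_fromEdgeSet_iff _ i e).2 ⟨F.mem_edgesWithin.2
        ⟨((hU e).1 he).1.1, fun v hv ↦ hSW (((hU e).1 he).1.2 v hv)⟩, ((hU e).1 he).2⟩
    · intro e he hed heU
      rw [ScaleFrame.mem_edgesWithin] at he
      refine ⟨he.1, ?_⟩
      by_contra hne
      exact heU ((hU e).2 ⟨⟨he.1, fun v hv ↦ not_not.1 fun hvS ↦ hne ⟨v, hv, he.2 v hv, hvS⟩⟩, hed⟩)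
    · intro ω u v hω huv
      refine Percolation.BlockExploration.openConnIn_of_agree huv fun x hx z hz hxz ↦ ⟨hxz, ?_⟩
      have h : (fromEdgeSet (↑(F.edgesWithin W) : Set (Sym2 V))).Adj x z := hω hxz
      rw [fromEdgeSet_adj, Finset.mem_coe, ScaleFrame.mem_edgesWithin] at h
      refine Finset.mem_coe.2 ((hU _).2 ⟨⟨h.1.1, fun v hv ↦ ?_⟩, ?_⟩)
      · rcases Sym2.mem_iff.1 hv with rfl | rfl
        exacts [hx, hz]
      · rw [Sym2.mk_isDiag_iff]
        exact h.2
  obtain ⟨U₁d, hU₁d, hG₁, hU₁E, hout₁, hrestr₁⟩ := hreg U₁ Set.inter_subset_left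
  obtain ⟨U₂d, hU₂d, hG₂, hU₂E, hout₂, hrestr₂⟩ := hreg U₂ Set.inter_subset_left
  have hdisj : Disjoint U₂d U₁d := Finset.disjoint_left.2 fun e he₂ he₁ ↦ by
    have hx := Sym2.out_fst_mem e
    have h1 : F.rad e.out.1 < a * M ^ 6 := (((hU₁d _).1 he₁).1.2 _ hx).2
    have h2 : a * M ^ 8 < F.rad e.out.1 := (((hU₂d _).1 he₂).1.2 _ hx).2
    linarith
  -- the wired sets of the two local measures, given everything off the region
  set W₁ : Set V := (R' ∪ Y) ∪ {x | ∃ e ∈ F.edgesWithin W, ¬ e.IsDiag ∧ e ∉ U₁d ∧ x ∈ e}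
  set W₂ : Set V := (R' ∪ Y) ∪ {x | ∃ e ∈ F.edgesWithin W, ¬ e.IsDiag ∧ e ∉ U₂d ∧ x ∈ e}
  have hW₁sub : W₁ ⊆ R' ∪ {v | a * M ^ 6 - F.η ≤ F.rad v} := by
    rintro x ((hxR | hxY) | ⟨e, heW, hed, heU, hxe⟩)
    · exact Or.inl hxR
    · exact Or.inr (show a * M ^ 6 - F.η ≤ F.rad x by linarith [hY x hxY])
    · obtain ⟨heE, v, hve, hvW, hvU⟩ := hout₁ e heW hed heU
      have hv6 : a * M ^ 6 ≤ F.rad v := not_lt.1 fun hlt ↦ hvU ⟨hvW, hlt⟩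
      exact Or.inr (show a * M ^ 6 - F.η ≤ F.rad x by
        linarith [(hadj e heE v hve x hxe hvW).2])
  have hW₂sub : W₂ ⊆ Y ∪ {v | F.rad v ≤ a * M ^ 8 + F.η} := by
    rintro x ((hxR | hxY) | ⟨e, heW, hed, heU, hxe⟩)
    · exact Or.inr (show F.rad x ≤ a * M ^ 8 + F.η by linarith [hR' x hxR])
    · exact Or.inl hxY
    · obtain ⟨heE, v, hve, hvW, hvU⟩ := hout₂ e heW hed heU
      have hv8 : F.rad v ≤ a * M ^ 8 := not_lt.1 fun hlt ↦ hvU ⟨hvW, hlt⟩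
      exact Or.inr (show F.rad x ≤ a * M ^ 8 + F.η by
        linarith [(hadj e heE v hve x hxe hvW).1])
  -- Steps 1–2: the product bound over the two regions (path splitting inside)
  have hmain := rcMeasure_real_le_mul_of_two_regions
    (fromEdgeSet (↑(F.edgesWithin W) : Set (Sym2 V))) hp' hq (R' ∪ Y) (hU₁E _) (hU₂E _) hdisj
    (W₁ := W₁) (W₂ := W₂) Set.subset_union_left Set.subset_union_left
    (fun e he heU x hx ↦ Or.inr ⟨e, ((mem_edgeFinset_fromEdgeSet_iff _ _ e).1 he).1,
      ((mem_edgeFinset_fromEdgeSet_iff _ _ e).1 he).2, heU, hx⟩)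
    (fun e he heU x hx ↦ Or.inr ⟨e, ((mem_edgeFinset_fromEdgeSet_iff _ _ e).1 he).1,
      ((mem_edgeFinset_fromEdgeSet_iff _ _ e).1 he).2, heU, hx⟩)
    (Percolation.isUpperSet_openCrossing U₁ R' (U₁ ∩ {v | a * M ^ 3 ≤ F.rad v}))
    (Percolation.isUpperSet_openCrossing U₂ (U₂ ∩ {v | F.rad v ≤ a * M ^ 11}) Y)
    (X := openCrossing W R' Y) fun ω hω hωX ↦ by
      obtain ⟨⟨r, hr, c, hc, hrc⟩, ⟨b, hb, y, hy, hby⟩⟩ :=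
        F.openCrossing_split ha hM hR hη hW hR' hY hω hωX
      exact ⟨⟨r, hr, c, hc, hrestr₁ ω r c hω hrc⟩, ⟨b, hb, y, hy, hrestr₂ ω b y hω hby⟩⟩
  -- Steps 3–5: monotonicity in the wired set inside each region, and the product
  rw [rcMeasure_congr_graph hG₁ p q W₁, rcMeasure_congr_graph hG₂ p q W₂] at hmain
  exact hmain.trans (mul_le_mul
    (rcMeasure_real_mono_wired_of_isUpperSet _ hp' hq hW₁sub
      (Percolation.isUpperSet_openCrossing _ _ _))
    (rcMeasure_real_mono_wired_of_isUpperSet _ hp' hq hW₂sub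
      (Percolation.isUpperSet_openCrossing _ _ _))
    measureReal_nonneg measureReal_nonneg)

end Literature.Probability.LatticeModels
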